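import Summits.QuantumFields.BalabanUV.T4Continuum.Spine.NE1p.DressedTowerWitnessSliceEnd

/-!
# T⁴ programme, spine estimate NE1′ (node O3b/H2) — A LIVE ACTION EXPONENT AT EVERY CUTOFF, part 1: the carried functionals
# DEFINED BY THE DRESSED RECURSION with background-dependent complex weights, reality only at the reference `Re`, THE NUMBER
# `s̄⁰ = ½` charged in full at every step, and attainment by a MONOTONICITY induction (formalisation crew
# `b2b-balaban-t4-ne1p-formalise-*`, leaf seat 03, generation 3, witness item W9; own-initiative consistency item, NOT a crew
# estimate row; INTENT CLAIMS.log 2026-08-20T10:18Z)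

Cell `pub-balaban`, sub-cell `t4`, BINDER-OWNERS row NE1′ (owner lineage t4-ne1p-p1).  ADDITIVE — imports this seat's row W7 part 2
`Spine/NE1p/DressedTowerWitnessSliceEnd` (p214558: the booking ∕ trajectory ∕ tower `BM K` ∕ `TM K` ∕ `towerM`, the ONE cutoff-free
schedule `Wm`, `c_M`, `a_K`, `δf_k = dfW k = ψ^{k+1}∕4`, the two-atom laws `flAt (atomW (k+1))`, the binder lemmas `hslM`, `hDμM`, …, and
through it row W5's `LW`, `ψ = LW⁻²`, `defW`, `dirW`, `UW` and `T4TrajectoryDensityWitness`'s `ref₁ = Re`, `base₁`) ONLY; modifies nothing.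

WHY.  In every K-UNIFORM witness of the crew (W3, W5, W5c, W7, W7c, W8) the (w2-act) families are inhabited by CONSTANTS: action
exponent `𝒜 ≡ 0`, reference `ref = id`, action margins `s ≡ 0` — «degenerate where declared» (row W5 part 1's header; typer R-T50 (i)
«toy labelled toy (𝒜 ≡ 0)»); their non-trivial inhabitation was rows W1∕W2's, at the single cutoff `K = 2`.  This item closes that
corner UNIFORMLY IN THE CUTOFF, with the SAME K-free `UW` and the SAME cutoff-free `Wm` as rows W5∕W7.

THE DATUM (this part).  On W7's booking `BM K` and trajectory `TM K` (booked sizes `a_K·ψ^{k+1}∕2`, currency `lin b 0 k = a_K·ψ^{k+1}∕2`,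
generation `a_K·(c_M + 3)`):
* §1 the ACTION exponent **`𝒜A U z := −U₀₀·z₀₀`** — background-DEPENDENT, complex on the complex window, REAL only at the reference
  `ref₁ U = Re U` (`ref ≠ id`: the complex window is genuinely used, cf. `T4TrajectoryDensityWitnessK2.not_realBase`); on the two-atom
  law `δ_0 + δ_{z_k}` (`(z_k)₀₀ = α_k := ψ^{k+1}∕4`) the weights are `1` and `e^{+α_k U₀₀}`, so the dressed operation is a U-DEPENDENT
  weighted two-point average (`wOp_flAt_gen`, total: both branches of `wOp`).
* §2 the carried functionals **DEFINED BY THE DRESSED RECURSION**: `FnA K 0 k U = f_k(U₀₀)` with `f_0(v) = a_K v`,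
  `f_{k+1}(v) = (f_k(v) + e^{α_k v} f_k(v + α_k))∕(1 + e^{α_k v})` (and the `wOp` fallback `f_k(v)` where `1 + e^{α_k v} = 0`) —
  NONLINEAR in the background from `k = 1` on; `hFn` holds AS AN EQUATION at every background (`FnA_succ`).
* §3 the REAL SHADOW `frA` (`f_k` on real backgrounds, where the weights are positive: `fcA_ofReal`) and the MONOTONICITY INDUCTION:
  with the logistic weight `p_k(v) = e^{α_k v}∕(1 + e^{α_k v})` (nondecreasing — the SIGN of the coupling is chosen for this),
  `g_k := f_k − a_K·id` is NONDECREASING for every `k`, by the identity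
  `g_{k+1}(v′) − g_{k+1}(v) = (1 − p_k(v′))·[g_k(v′) − g_k(v)] + p_k(v′)·[g_k(v′+α_k) − g_k(v+α_k)] + (p_k(v′) − p_k(v))·[f_k(v+α_k) − f_k(v)]`
  (`grA_mono`; no Lipschitz constant is needed) — hence `f_k(δ) − f_k(0) ≥ a_K·δ` (`frA_gap`).
* §4 the binders on the datum: births `hslA` (at its own scale a generation is W7's birth functional, `FnA_self`); **`hB` =
  `realBaseAt_A`** (reality at `Re U₀` only); **`hE` = `exponentSliceAt_A` with the action margin `s b k := ½ = s̄⁰` AT EVERY STEP OF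
  EVERY CUTOFF** — THE NUMBER charged in full (`hs₀` with equality; with `m = ¼`, `N₀ = A₀ = 1`, `ρ′ = ½` the (w6) smallness
  `m·N₀A₀∕(1−ρ′) ≤ 1 − s̄⁰` of `UW` is ALSO an equality: the dressed budget `s + m·Σ envVar ≤ 1` is met with no slack on either
  side); the oscillation bound is `α_k·(‖U₀₀‖ + (ϱc k + 2) + ‖Re U₀₀‖) ≤ (ψ∕4)·(c_M∕2 + 3) ≤ ½` from `c_M ≤ 2`, `ψ ≤ ¼`
  (`cM_le_two`, `psi_le_quarter`); **attainment `hlinA`** from `frA_gap` along W5's gauge direction `dirW (k+1)` — the SAME currency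
  `lin b 0 k = a_K·ψ^{k+1}∕2` as W7, now under a nonlinear dressing; `hbirthA` for any gate.
Part 2 (`DressedTowerWitnessActionEnd`) feeds these to leaf-04's assembled slice-window END BY NAME and reaches END-B ∕ the root.

DECLARED DEGENERACIES.  Observable coupling `c := 0` (the H2 dictionary `hQ` is then the identity `0 = 0·Σ`; the LIVE-`𝒬` corner is
row W7's — a JOINTLY live `(𝒜, 𝒬)` would need second-difference control of the dressing, NOT attempted here); `rel = Eq`; two-atom
laws; zero regeneration; one family.  A decided toy: [folklore] kernel mathematics, 0 sorry, 0 citations, no `def … : Prop`;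
NOTHING of Bałaban's densities or of [Balaban1989LargeFieldII] (1.65)∕(1.71)–(1.75) is encoded (CONTEXT only).

HONEST FRAMING.  Headline (c4): «the (w2-act) families of the assembled slice-window face are inhabitable at EVERY cutoff by a LIVE
complex action exponent, real only at `ref = Re`, with THE NUMBER `½` charged in full at every step — jointly with all other families,
ONE K-free `U`, ONE cutoff-free schedule; non-vacuity of SHAPES; NE1′ ⇐ the named binders, NOT proved»; spine PROVED 0∕9.  Rung (B)+1
on ONE finite four-torus — NOT infinite volume, NOT a mass gap, NOT OS on ℝ⁴, NOT Clay, NOT summit progress.  HONEST DEPENDENCY: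
continuum YM on T⁴ ⇐ BetaPertH ∧ nine spine estimates (0/9 proved); BetaPertH ⇐ (D1) ∧ (D4) ∧ CAP+tail; G-an2-4 gates asym, D1 and
NE2/3/4.
-/

noncomputable section

namespace Summit.QuantumFields.BalabanUV.T4Continuum.NE1p.DressedTowerWitnessAction

open MeasureTheory Set Metric Filter Finset
open scoped BigOperators
open Literature.MathematicalPhysics.QuantumFieldTheory.Balaban1983to89
open Literature.MathematicalPhysics.QuantumFieldTheory.Balaban1983to89.T4TermFormat
open Literature.MathematicalPhysics.QuantumFieldTheory.Balaban1983to89.T4TermFormat.Booking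
open Literature.MathematicalPhysics.QuantumFieldTheory.Balaban1983to89.T4GatedBooking
open Literature.MathematicalPhysics.QuantumFieldTheory.Balaban1983to89.T4TrajectoryComparison
open T4TrajectoryModulus (bondBall bondBall_add_mem bondBall_latMove_add_mem bondBall_diam)
open T4BlockTransport (Fld NDir latMove latN Site norm_dir_le)
open T4BirthChartTransport (GaugeInvariant BirthSlice RelGauge)
open T4TrajectoryDensity
open Summit.QuantumFields.BalabanUV.T4Continuum.T4TrajectoryDensityDressed
open Summit.QuantumFields.BalabanUV.T4Continuum.T4TrajectoryDensityWitness
open Summit.QuantumFields.BalabanUV.T4Continuum.NE1p.DressedRoot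
open Summit.QuantumFields.BalabanUV.T4Continuum.NE1p.DressedUniformConstants
open Summit.QuantumFields.BalabanUV.T4Continuum.NE1p.DressedWindowScheduleWin
open Summit.QuantumFields.BalabanUV.T4Continuum.NE1p.DressedWindowScheduleModWin
open Summit.QuantumFields.BalabanUV.T4Continuum.NE1p.DressedTowerWitness
open Summit.QuantumFields.BalabanUV.T4Continuum.NE1p.DressedTowerWitnessSlice

/-! ## §1 The live action exponent and the background-dependent two-point weights [decided toy] -/

/-- **THE ACTION EXPONENT** `𝒜A U z := −U₀₀·z₀₀` [decided toy]: background-DEPENDENT, complex for complex backgrounds, real at real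
ones (the toy's stand-in for «the quadratic form in B and the term V(X̃) depend on (𝐔,𝐉)» — CONTEXT only, nothing of Bałaban's). [folklore] -/
def 𝒜A (U z : Fld 4 ℂ) : ℂ := -(ev₀₀ U * ev₀₀ z)

/-- [arith] [folklore] The second atom of step `k` has `(z_k)₀₀ = α_k = δf_k = ψ^{k+1}∕4`. -/
theorem ev₀₀_atom_succ (k : ℕ) : ev₀₀ (atomW (k + 1)) = ((dfW k : ℝ) : ℂ) := rfl

/-- [arith] [folklore] `ψ ≤ ¼` (`L ≥ 2`). -/
theorem psi_le_quarter : (LW ^ 2)⁻¹ ≤ 1 / 4 := by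
  have h4 : (4 : ℝ) ≤ LW ^ 2 := by nlinarith [two_le_LW]
  calc (LW ^ 2)⁻¹ ≤ (4 : ℝ)⁻¹ := inv_anti₀ (by norm_num) h4
    _ = 1 / 4 := by norm_num

/-- [arith] [folklore] The birth-window radius is at most `2`. -/
theorem cM_le_two : cM ≤ 2 := by
  have h0 := psi_pos; have h1 := psi_le_quarter
  unfold cM
  rw [div_le_iff₀ (by linarith)]
  nlinarith

/-- The weight at the reference atom `0` is `1`. [folklore] -/
theorem expWeight_A_zero (U : Fld 4 ℂ) : expWeight base₁ (𝒜A + zeroExp) U 0 = 1 := by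
  simp [expWeight_apply, base₁, zeroExp, 𝒜A]

/-- The weight at the second atom of step `k` is `e^{α_k·U₀₀}` — background-DEPENDENT. [folklore] -/
theorem expWeight_A_atom (k : ℕ) (U : Fld 4 ℂ) :
    expWeight base₁ (𝒜A + zeroExp) U (atomW (k + 1)) = Complex.exp (ev₀₀ U * ((dfW k : ℝ) : ℂ)) := by
  rw [expWeight_apply, Pi.add_apply, Pi.add_apply, 𝒜A, zeroExp, ev₀₀_atom_succ, base₁, add_zero, neg_neg, Complex.ofReal_one,
    one_mul]

/-- **THE DRESSED OPERATION ON A TWO-ATOM LAW IN CLOSED FORM, FOR ANY WEIGHT** [folklore]: the normalised weighted two-point average on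
the good set, the `wOp` fallback `h 0` where the normaliser `ω_U(0) + ω_U(a)` vanishes (total, both branches). -/
theorem wOp_flAt_gen (ω : Fld 4 ℂ → Fld 4 ℂ → ℂ) (a U : Fld 4 ℂ) (h : Fld 4 ℂ → ℂ) :
    wOp ω (flAt a) 0 U h =
      if ω U 0 + ω U a = 0 then h 0 else (ω U 0 + ω U a)⁻¹ * (ω U 0 * h 0 + ω U a * h a) := by
  have hint : ∫ z, ω U z ∂flAt a = ω U 0 + ω U a := integral_flAt a _
  by_cases hs : ω U 0 + ω U a = 0
  · rw [if_pos hs, wOp_of_neg (fun hc => hc.2 (by rw [hint, hs]))]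
  · rw [if_neg hs, wOp_of_pos (integrable_flAt a _) (by rw [hint]; exact hs), hint, integral_flAt]
    simp only [smul_eq_mul]

/-! ## §2 The carried functionals, DEFINED by the dressed recursion [decided toy] -/

/-- THE SCALAR RECURSION in the background coordinate `v = U₀₀` (complex, total): `f_0(v) = a_K v`,
`f_{k+1}(v) = (f_k(v) + e^{α_k v}·f_k(v + α_k))∕(1 + e^{α_k v})`, and `f_k(v)` where `1 + e^{α_k v} = 0`. [folklore] -/
def fcA (K : ℕ) : ℕ → ℂ → ℂ
  | 0 => fun v => (aM K : ℂ) * v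
  | k + 1 => fun v =>
      if 1 + Complex.exp (v * ((dfW k : ℝ) : ℂ)) = 0 then fcA K k v
      else (1 + Complex.exp (v * ((dfW k : ℝ) : ℂ)))⁻¹ *
        (1 * fcA K k v + Complex.exp (v * ((dfW k : ℝ) : ℂ)) * fcA K k (v + ((dfW k : ℝ) : ℂ)))

/-- THE CARRIED FUNCTIONALS at cutoff `K` [decided toy]: generation `0` at scale `k` is `f_k(U₀₀)`; later generations `0`. [folklore] -/
def FnA (K : ℕ) (k' k : ℕ) (U : Fld 4 ℂ) : ℂ := if k' = 0 then fcA K k (ev₀₀ U) else 0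

/-- **`hFn` AS AN EQUATION AT EVERY BACKGROUND**: the step `k → k+1` IS the dressed operation with the LIVE action weights
`e^{−𝒜A}` on the two-atom law applied to the translates (both branches of the total `wOp`). [folklore] -/
theorem FnA_succ (K k' k : ℕ) (U : Fld 4 ℂ) :
    FnA K k' (k + 1) U =
      wOp (expWeight base₁ (𝒜A + zeroExp)) (flAt (atomW (k + 1))) 0 U (fun z => FnA K k' k (U + z)) := by
  rw [wOp_flAt_gen, expWeight_A_zero, expWeight_A_atom]
  by_cases hk : k' = 0
  · subst hk
    simp only [FnA, ↓reduceIte, fcA, ev₀₀_add, add_zero, ev₀₀_atom_succ]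
  · simp [FnA, hk]

/-! ## §3 The real shadow and the monotonicity induction [folklore] -/

/-- The atom weight at a REAL background: `e^{α_k v} > 0`. [folklore] -/
def wA (k : ℕ) (v : ℝ) : ℝ := Real.exp (v * dfW k)

/-- [arith] [folklore] -/ theorem wA_pos (k : ℕ) (v : ℝ) : 0 < wA k v := Real.exp_pos _
/-- [arith] [folklore] -/ theorem one_add_wA_pos (k : ℕ) (v : ℝ) : 0 < 1 + wA k v := by linarith [wA_pos k v]

/-- [folklore] The atom weight is nondecreasing in the real background (`α_k > 0`). -/
theorem wA_mono (k : ℕ) : Monotone (wA k) := fun _ _ h =>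
  Real.exp_le_exp.mpr (mul_le_mul_of_nonneg_right h (dfW_pos k).le)

/-- The logistic weight of the shifted value: `p_k(v) = e^{α_k v}∕(1 + e^{α_k v})`. [folklore] -/
def pA (k : ℕ) (v : ℝ) : ℝ := (1 + wA k v)⁻¹ * wA k v

/-- [arith] [folklore] -/
theorem pA_nonneg (k : ℕ) (v : ℝ) : 0 ≤ pA k v :=
  mul_nonneg (inv_nonneg.mpr (one_add_wA_pos k v).le) (wA_pos k v).le

/-- [arith] [folklore] -/
theorem pA_le_one (k : ℕ) (v : ℝ) : pA k v ≤ 1 := by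
  unfold pA
  rw [inv_mul_le_iff₀ (one_add_wA_pos k v)]
  linarith [wA_pos k v]

/-- [folklore] The logistic weight is NONDECREASING in the real background — the sign of the coupling is chosen for this. -/
theorem pA_mono (k : ℕ) : Monotone (pA k) := by
  intro v v' h
  have hw := wA_mono k h
  have h0 := wA_pos k v; have h0' := wA_pos k v'
  unfold pA
  rw [inv_mul_eq_div, inv_mul_eq_div, div_le_div_iff₀ (by linarith) (by linarith)]
  nlinarith

/-- THE REAL SHADOW of the scalar recursion: on real backgrounds the normaliser is positive and `f_k` is this real function. [folklore] -/
def frA (K : ℕ) : ℕ → ℝ → ℝ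
  | 0 => fun v => aM K * v
  | k + 1 => fun v => (1 + wA k v)⁻¹ * (1 * frA K k v + wA k v * frA K k (v + dfW k))

/-- [folklore] `f_k` restricted to real backgrounds IS the real shadow (the good branch of `wOp` throughout). -/
theorem fcA_ofReal (K : ℕ) : ∀ (k : ℕ) (v : ℝ), fcA K k (v : ℂ) = ((frA K k v : ℝ) : ℂ)
  | 0, v => by simp only [fcA, frA]; push_cast; ring
  | k + 1, v => by
    have e : Complex.exp ((v : ℂ) * ((dfW k : ℝ) : ℂ)) = ((wA k v : ℝ) : ℂ) := by
      rw [wA, Complex.ofReal_exp]; push_cast; ring_nf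
    have hne : (1 : ℂ) + Complex.exp ((v : ℂ) * ((dfW k : ℝ) : ℂ)) ≠ 0 := by
      rw [e]; exact_mod_cast (one_add_wA_pos k v).ne'
    simp only [fcA, frA, if_neg hne]
    rw [e, fcA_ofReal K k v, show (v : ℂ) + ((dfW k : ℝ) : ℂ) = ((v + dfW k : ℝ) : ℂ) by push_cast; ring,
      fcA_ofReal K k (v + dfW k)]
    push_cast
    ring

/-- [folklore] The real step in INCREMENT FORM: `f_{k+1}(v) = f_k(v) + p_k(v)·(f_k(v + α_k) − f_k(v))`. -/
theorem frA_succ_eq (K k : ℕ) (v : ℝ) : frA K (k + 1) v = frA K k v + pA k v * (frA K k (v + dfW k) - frA K k v) := by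
  have h := one_add_wA_pos k v
  simp only [frA, pA]
  field_simp
  ring

/-- THE DRESSING: `g_k := f_k − a_K·id` on real backgrounds. [folklore] -/
def grA (K k : ℕ) (v : ℝ) : ℝ := frA K k v - aM K * v

/-- **THE MONOTONICITY INDUCTION** [folklore]: the dressing `g_k` is NONDECREASING for every `k` — by the three-term identity of the
header, each term a product of nonnegatives (`p_k ∈ [0,1]` nondecreasing, `g_k` and hence `f_k = g_k + a_K·id` nondecreasing by
induction, `α_k ≥ 0`).  No Lipschitz constant of the dressing is needed. -/
theorem grA_mono (K : ℕ) : ∀ k, Monotone (grA K k)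
  | 0 => fun v v' _ => by simp [grA, frA]
  | k + 1 => by
    intro v v' hvv'
    have ih := grA_mono K k
    have hf : Monotone (frA K k) := fun x y hxy => by
      have := ih hxy; simp only [grA] at this; nlinarith [aM_pos K]
    have key : grA K (k + 1) v' - grA K (k + 1) v =
        (1 - pA k v') * (grA K k v' - grA K k v) + pA k v' * (grA K k (v' + dfW k) - grA K k (v + dfW k)) +
          (pA k v' - pA k v) * (frA K k (v + dfW k) - frA K k v) := by
      simp only [grA, frA_succ_eq]; ring
    have hα := (dfW_pos k).le
    have t1 : 0 ≤ (1 - pA k v') * (grA K k v' - grA K k v) :=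
      mul_nonneg (sub_nonneg.mpr (pA_le_one k v')) (sub_nonneg.mpr (ih hvv'))
    have t2 : 0 ≤ pA k v' * (grA K k (v' + dfW k) - grA K k (v + dfW k)) :=
      mul_nonneg (pA_nonneg k v') (sub_nonneg.mpr (ih (show v + dfW k ≤ v' + dfW k by linarith)))
    have t3 : 0 ≤ (pA k v' - pA k v) * (frA K k (v + dfW k) - frA K k v) :=
      mul_nonneg (sub_nonneg.mpr (pA_mono k hvv')) (sub_nonneg.mpr (hf (show v ≤ v + dfW k by linarith)))
    linarith

/-- **THE GAP** [folklore]: along the real background axis the dressed functional moves by AT LEAST the undressed amount: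
`f_k(δ) − f_k(0) ≥ a_K·δ` for `δ ≥ 0`, at every step of every cutoff. -/
theorem frA_gap (K k : ℕ) {δ : ℝ} (hδ : 0 ≤ δ) : aM K * δ ≤ frA K k δ - frA K k 0 := by
  have h := grA_mono K k hδ
  simp only [grA, mul_zero, sub_zero] at h
  linarith

/-! ## §4 The binders of the assembled slice-window END on the datum [folklore] -/

/-- At its own scale a generation is W7's birth functional (`a_K·U₀₀`, no dressing yet; later generations `0`). [folklore] -/
theorem FnA_self (K k' : ℕ) : FnA K k' k' = FnM K k' k' := by
  funext U
  by_cases h : k' = 0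
  · subst h; simp [FnA, FnM, fcA, shiftM]
  · simp [FnA, FnM, h]

/-- `hsl` (w1): the birth slices — W7's `hslM` verbatim (the birth functional is undressed). [folklore] -/
theorem hslA (K : ℕ) (b : (BM K).Birth) (k' : ℕ) :
    BirthSlice (FnA K k' k') latMove latN (bondBall 4 (Wm.ρw k') : Set (Fld 4 ℂ)) 1 1 ((TM K).gen b k') := by
  rw [FnA_self]; exact hslM K b k'

/-- **`hB` (w2-act) — THE REAL REGULAR REFERENCE** [folklore]: `base ≡ 1 ≥ 0` with full support, and AT THE REFERENCE `Re U₀` of every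
window point the live exponent `𝒜A (Re U₀) z = −(Re U₀₀)·z₀₀` is REAL at both atoms and integrable — reality is asked only on the
image of `ref₁ = Re`, the window itself is complex (`ref ≠ id`). -/
theorem realBaseAt_A (k : ℕ) (S : Set (Fld 4 ℂ)) : RealBaseAt ref₁ base₁ 𝒜A (flAt (atomW (k + 1))) S := by
  refine ⟨Eventually.of_forall fun _ => zero_le_one, ?_, fun U₀ _ => ⟨aesm_flAt _ _, ?_, integrable_flAt _ _⟩⟩
  · rw [show Function.support base₁ = univ from Function.support_const one_ne_zero]
    simp [flAt]
  · exact ae_flAt.mpr ⟨by simp [𝒜A], by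
      rw [𝒜A, ev₀₀_ref₁, ev₀₀_atom_succ, ← Complex.ofReal_mul, ← Complex.ofReal_neg, Complex.ofReal_im]⟩

/-- **`hE` (w2-act) — THE EXPONENT SLICE ABOUT THE REFERENCE WITH THE NUMBER CHARGED IN FULL** [folklore]: on the window
`bondBall (ρw (k+1))`, for chart directions of norm `≤ wc (k+1)`, with `Ω = ball 0 ((ϱc k + 2)∕N)`: `t ↦ 𝒜A (U₀ + t·p) z` is entire,
and its oscillation against the REFERENCE value `𝒜A (Re U₀) z` is `≤ α_k·(‖U₀₀‖ + ϱc k + 2 + ‖Re U₀₀‖) ≤ ½ = s̄⁰` at the atom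
(`0` at the atom `0`) — the action margin `s b k = ½` at EVERY step of EVERY cutoff. -/
theorem exponentSliceAt_A (k : ℕ) :
    ExponentSliceAt ref₁ 𝒜A (flAt (atomW (k + 1))) latMove latN (bondBall 4 (Wm.ρw (k + 1)) : Set (Fld 4 ℂ))
      (Wm.wc (k + 1)) (Wm.ϱc k) (1 / 2) := by
  intro U₀ hU₀ p hp hp1
  have hN1 : latN p ≤ 1 := hp1.trans (Wm.hwcw (k + 1))
  have hψ0 := psi_pos; have hψ4 := psi_le_quarter; have hc2 := cM_le_two; have hc0 := cM_pos
  have hP1 : ((LW ^ 2)⁻¹) ^ (k + 1) ≤ (LW ^ 2)⁻¹ := by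
    rw [pow_succ]
    exact mul_le_of_le_one_left hψ0.le (psi_pow_le_one k)
  have hP0 : 0 ≤ ((LW ^ 2)⁻¹) ^ (k + 1) := pow_nonneg hψ0.le _
  have hv : ‖ev₀₀ U₀‖ ≤ cM * ((LW ^ 2)⁻¹) ^ (k + 1) := by rw [← Wm_ρw]; exact hU₀ 0 0
  have hϱ : Wm.ϱc k = ((LW ^ 2)⁻¹) ^ (k + 1) := by rw [Wm_ϱc, one_mul]
  refine ⟨ball 0 ((Wm.ϱc k + 2) / latN p), isOpen_ball, discs_subset_ball hp hN1 (by linarith), fun t _ => aesm_flAt _ _,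
    Eventually.of_forall fun z => ?_, ae_flAt.mpr ⟨fun t _ => by simp [𝒜A], fun t ht => ?_⟩⟩
  · show DifferentiableOn ℂ (fun t => 𝒜A (latMove U₀ p t) z) _
    simp only [𝒜A, ev₀₀_latMove]; fun_prop
  · have h3 := norm_t_mul_le p hp ht
    have hre : ‖(((ev₀₀ U₀).re : ℝ) : ℂ)‖ ≤ cM * ((LW ^ 2)⁻¹) ^ (k + 1) := by
      rw [Complex.norm_real, Real.norm_eq_abs]; exact (Complex.abs_re_le_norm _).trans hv
    rw [show 𝒜A (latMove U₀ p t) (atomW (k + 1)) - 𝒜A (ref₁ U₀) (atomW (k + 1)) =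
      -(((ev₀₀ U₀ + t * ev₀₀ p.1.1) - (((ev₀₀ U₀).re : ℝ) : ℂ)) * ((dfW k : ℝ) : ℂ)) by
        rw [𝒜A, 𝒜A, ev₀₀_latMove, ev₀₀_ref₁, ev₀₀_atom_succ]; ring]
    rw [norm_neg, norm_mul, Complex.norm_real, Real.norm_eq_abs, abs_of_pos (dfW_pos k)]
    have hn : ‖(ev₀₀ U₀ + t * ev₀₀ p.1.1) - (((ev₀₀ U₀).re : ℝ) : ℂ)‖ ≤
        cM * ((LW ^ 2)⁻¹) ^ (k + 1) + (Wm.ϱc k + 2) + cM * ((LW ^ 2)⁻¹) ^ (k + 1) :=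
      calc _ ≤ ‖ev₀₀ U₀ + t * ev₀₀ p.1.1‖ + ‖(((ev₀₀ U₀).re : ℝ) : ℂ)‖ := norm_sub_le _ _
        _ ≤ (‖ev₀₀ U₀‖ + ‖t * ev₀₀ p.1.1‖) + ‖(((ev₀₀ U₀).re : ℝ) : ℂ)‖ := by gcongr; exact norm_add_le _ _
        _ ≤ _ := by gcongr
    rw [hϱ] at hn
    unfold dfW
    calc ‖(ev₀₀ U₀ + t * ev₀₀ p.1.1) - (((ev₀₀ U₀).re : ℝ) : ℂ)‖ * (((LW ^ 2)⁻¹) ^ (k + 1) / 4)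
        ≤ (cM * ((LW ^ 2)⁻¹) ^ (k + 1) + (((LW ^ 2)⁻¹) ^ (k + 1) + 2) + cM * ((LW ^ 2)⁻¹) ^ (k + 1)) *
            (((LW ^ 2)⁻¹) ^ (k + 1) / 4) := mul_le_mul_of_nonneg_right hn (by positivity)
      _ ≤ (2 * (1 / 4) + ((1 / 4) + 2) + 2 * (1 / 4)) * ((1 / 4) / 4) := by
          gcongr <;> linarith
      _ ≤ 1 / 2 := by norm_num

/-- **`hlin` — ATTAINMENT SURVIVES THE NONLINEAR DRESSING** [folklore]: base `0 ∈ 𝒦`, gauge image `δ_{k+1}·e₀₀` along W5's `dirW (k+1)`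
(defect `ψ^{k+1}∕2`); both backgrounds are REAL, so `FnA K 0 k U₁ − FnA K 0 k 0 = f_k(δ_{k+1}) − f_k(0) ≥ a_K·δ_{k+1} = lin b 0 k`
by the gap `frA_gap`; later generations `lin = 0`. -/
theorem hlinA (K : ℕ) (b : (BM K).Birth) (k' k : ℕ) (ε : ℝ) (hε : 0 < ε) :
    ∃ U₀ ∈ (bondBall 4 (Wm.ρw k) : Set (Fld 4 ℂ)), ∃ U₁ : Fld 4 ℂ,
      RelGauge (fun U U' : Fld 4 ℂ => U = U') latMove latN U₀ U₁ (defW (k + 1)) ∧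
        (TM K).lin b k' k ≤ ‖FnA K k' k U₁ - FnA K k' k U₀‖ + ε := by
  refine ⟨0, zero_mem_windowM k, latMove 0 (dirW (k + 1)) 1, ⟨dirW (k + 1), defW_pos (k + 1), le_rfl, rfl⟩, ?_⟩
  show (if k' = 0 then aM K * defW (k + 1) else 0) ≤ _
  by_cases hk : k' = 0
  · subst hk
    have h0 : fcA K k (ev₀₀ (0 : Fld 4 ℂ)) = ((frA K k 0 : ℝ) : ℂ) := by
      rw [ev₀₀_zero, ← Complex.ofReal_zero, fcA_ofReal]
    have h1 : fcA K k (ev₀₀ (latMove 0 (dirW (k + 1)) 1)) = ((frA K k (defW (k + 1)) : ℝ) : ℂ) := by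
      rw [ev₀₀_move_dirW, fcA_ofReal]
    have hgap := frA_gap K k (defW_pos (k + 1)).le
    simp only [↓reduceIte, FnA, h0, h1]
    rw [← Complex.ofReal_sub, Complex.norm_real, Real.norm_eq_abs,
      abs_of_pos (lt_of_lt_of_le (mul_pos (aM_pos K) (defW_pos (k + 1))) hgap)]
    linarith
  · simp only [if_neg hk]; positivity

/-- (w1)+(w5b) `hbirth` for ANY gate, by `birthsFromOld_of_diag`: `C·gen b 0 = 2·a_K·(c_M + 3) = τ^K` EXACTLY (W7's arithmetic). [folklore] -/
theorem hbirthA (K : ℕ) (Gate : ℕ → Prop) :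
    (TM K).BirthsFromOld (4 * (1 / 2) / 1) (fun _ : ℕ => (LW ^ 2)⁻¹ * alphaCell (1 / 2))
      (twoRate 1 (rhoOne (LW ^ 2)⁻¹ (4 * (1 / 2) / 1) 0 (1 / 2)) (LW⁻¹ ^ 3) (BM K).K) Gate :=
  Trajectory.birthsFromOld_of_diag fun b => by
    show 4 * (1 / 2) / 1 * (if (0 : ℕ) = 0 then aM K * (cM + 3) else 0) ≤
      twoRate 1 (rhoOne (LW ^ 2)⁻¹ (4 * (1 / 2) / 1) 0 (1 / 2)) (LW⁻¹ ^ 3) K 0 0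
    have hc : 0 < cM + 3 := by linarith [cM_pos]
    simp only [↓reduceIte, twoRate, Nat.sub_zero, pow_zero, mul_one, one_mul]
    unfold aM
    rw [show 4 * (1 / 2 : ℝ) / 1 * ((LW⁻¹ ^ 3) ^ K / (2 * (cM + 3)) * (cM + 3)) = (LW⁻¹ ^ 3) ^ K by field_simp; ring]

/-- NON-DEGENERACY of the live weights [folklore]: the dressing genuinely depends on the background — the logistic weight separates
the backgrounds `0` and `1` at every step (`p_k(0) = ½ < p_k(1)`). -/
theorem pA_zero_lt_pA_one (k : ℕ) : pA k 0 < pA k 1 := by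
  have h0 : wA k 0 = 1 := by simp [wA]
  have h1 : 1 < wA k 1 := by
    rw [wA, one_mul]; exact Real.one_lt_exp_iff.mpr (dfW_pos k)
  have hw1 := wA_pos k 1
  unfold pA
  rw [h0, inv_mul_eq_div, inv_mul_eq_div, div_lt_div_iff₀ (by norm_num) (by linarith)]
  nlinarith

end Summit.QuantumFields.BalabanUV.T4Continuum.NE1p.DressedTowerWitnessAction

end
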